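import Literature.Analysis.FunctionSpaces.BesselK
import Mathlib.MeasureTheory.Integral.IntervalIntegral.Basic
import Mathlib.Analysis.SpecialFunctions.Integrals.Basic
import HarnessLib

/-!
# Modified Bessel functions `I_n`, `K_ν` on the real line, Bessel moments `IKM(a,b;n)`, and the Bailey–Borwein–Broadhurst–Glasser sum rule (Zhou 2017)

Topic `Literature/Analysis/FunctionSpaces` (next to `BesselJ`, `BesselK`); `cite` item wi-15857
(route KontsevichZagierPeriods/WickWedge, crux `SumRuleSix` and its kill switch: the `k = 6`
Bessel-moment sum rule `π² ∫₀^∞ I₀³K₀³ t dt = 3 ∫₀^∞ I₀K₀⁵ t dt`).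

Sources read:

* Y. Zhou, *Hilbert transforms and sum rules of Bessel moments*, Ramanujan J. 48 (2019)
  159–172, arXiv:1706.01068 (`lit read arxiv:1706.01068`, pp. 3, 5): the Bessel moments
  "`IKM(a,b;n) := ∫₀^∞ [I₀(t)]^a [K₀(t)]^b tⁿ dt`, where the non-negative integers `a, b, n` are
  chosen to ensure convergence" (p. 3); Conjecture 1.1 = **Theorem 3.3 (B³G sum rule)**: "We have
  `Z_{2n,n-2k} := ∑_{m=0}^{⌊n/2⌋} (-1)^m binom(n,2m) ∫₀^∞ [π I₀(t)]^{n-2m} [K₀(t)]^{n+2m} t^{n-2k} dt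
  = 0` for all integer pairs `(n, k)` meeting the requirements `n ≥ 2k ≥ 2`." and, on the way
  (p. 5), "`∫₀^∞ [πI₀(t)]³[K₀(t)]³ t dt - 3∫₀^∞ πI₀(t)[K₀(t)]⁵ t dt = Z_{6,1}`" `= 0`.
* J. Fresán, C. Sabbah, J.-D. Yu, *Quadratic relations between Bessel moments*, Algebra Number
  Theory 17 (2023) 541–602, arXiv:2006.02702 (`lit read`, pp. 17, 21): §5.2
  `IKM_k(i,j) = (-1)^{k-i} 2^{k-j} (πi)^i ∫₀^∞ I₀(t)^i K₀(t)^{k-i} t^j dt`; **Cor. 7 (Sum rule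
  identities)** `∑_{i=0}^{k''} binom(k/2, 2i+1) IKM^c_k(2i+1, 2j-1) = 0` (`k` even,
  `k'' = ⌊(k-1)/4⌋`, `1 ≤ j ≤ 2k''` if `k ≡ 2 mod 4`); at `k = 6`, `j = 1` no regularisation enters
  (Def. 4, "otherwise" case) and the relation reads `3·IKM₆(1,1) + IKM₆(3,1) = 0`, i.e.
  `-96πi ∫ I₀K₀⁵t + 32π³i ∫ I₀³K₀³t = 0` — the same identity; Rem. 8: "these sum rule identities
  were proved by Zhou by analytic means".
* DLMF §10.32: `I₀(z) = (1/π)∫₀^π e^{±z cos θ} dθ` (10.32.1), `I_n(z) = (1/π)∫₀^π e^{z cos θ}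
  cos(nθ) dθ` (10.32.3, `n ∈ ℤ`), `K_ν(z) = ∫₀^∞ e^{-z cosh t} cosh(νt) dt` (10.32.9).

## Content

* `besselI n x` — the modified Bessel function of the first kind of integer order on `ℝ`, by the
  integral DLMF 10.32.3 (mirrors the tree's `besselJ`); `besselI_zero_eq`,
  `besselI_zero_apply_zero : I₀(0) = 1`, `besselI_zero_pos : 0 < I₀(x)` (proved).
* `besselKReal ν x` — the real Macdonald function, DLMF 10.32.9, i.e. the real part of the tree's
  complex `besselK` (`ofReal_besselKReal`, from `besselK_ofReal`); `besselKReal_pos` for `x > 0`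
  (from `besselK_ofReal_re_pos`).
* `besselMoment a b n = IKM(a,b;n) = ∫₀^∞ I₀^a K₀^b tⁿ dt` (Zhou's normalisation) and
  `zhouZ n j = ∑_{m ≤ ⌊n/2⌋} (-1)^m binom(n,2m) ∫₀^∞ (πI₀)^{n-2m} K₀^{n+2m} t^j dt` (so
  `Z_{2n,n-2k} = zhouZ n (n-2k)`), with Lean's Bochner set integral over `Ioi 0` (all moments
  occurring in the theorem converge absolutely: at `∞`, `I₀K₀ ~ 1/(2t)` and extra `K₀`'s decay
  exponentially; at `0`, `K₀ ~ -log t`; so no junk value is involved).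
* The NAMED FACT `Zhou2017_B3G_sumRule` = Thm. 3.3 as printed (statement only), and its PROVED
  specialisation `(n, k) = (3, 1)`: `Zhou2017_B3G_sumRule.six_one :
  π ^ 2 * besselMoment 3 3 1 = 3 * besselMoment 1 5 1` — the requested `k = 6` sum rule
  (FSY Cor. 7, `k = 6`, `j = 1`; numerically `IKM(3,3;1) = 0.76456563505…`,
  `IKM(1,5;1) = 2.51532011887…`, `π² · 0.764565635 = 7.5460 = 3 · 2.515320119`).

NOT here: the rational 6-dimensional "banana" representations of these two moments used by the
route (`val R(3,3;1) = 3 val R(1,5;1)` needs `x = tan(θ/2)`, `x = eᵘ` and the Schwinger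
`t`-integration — the route's own items `TInsertion`/`SumRuleSix`); FSY's regularised moments,
Thm. 1 (quadratic relations) and the `k ≡ 0 mod 4` rules; Zhou's conjugate rule `Y` and the
Crandall-number integrality (Thm. 3.5); convergence/integrability lemmas for the moments.

## References

* [Zhou2017] Y. Zhou, Hilbert transforms and sum rules of Bessel moments, Ramanujan J. 48 (2019)
  159–172, doi:10.1007/s11139-017-9945-y, arXiv:1706.01068 — (1.1), Thm. 3.3, eq. before
  Prop. 3.2 (`Z_{6,1} = 0`).
* [FresanSabbahYu2023] J. Fresán, C. Sabbah, J.-D. Yu, Quadratic relations between Bessel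
  moments, Algebra Number Theory 17 (2023), §5.2, Def. 4, Cor. 7, Rem. 8.
* [DLMF] NIST Digital Library of Mathematical Functions, §10.32 (10.32.1, 10.32.3, 10.32.9).
* [BaileyEtAl2008] D. H. Bailey, J. M. Borwein, D. Broadhurst, M. L. Glasser, Elliptic integral
  evaluations of Bessel moments, J. Phys. A 41 (2008) (the conjecture; cited through Zhou).
-/

noncomputable section

open MeasureTheory Set Real

namespace Literature.Analysis.FunctionSpaces

/-! ### `I_n` on the real line -/

/-- **The modified Bessel function of the first kind** of integer order `n` on `ℝ`:
`I_n(x) = π⁻¹ ∫₀^π e^{x cos θ} cos(nθ) dθ` (DLMF 10.32.3, valid for `n ∈ ℤ`; for `n = 0` this is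
10.32.1). An interval integral of a continuous function, so no junk value. [cite: DLMF, 10.32.3] -/
def besselI (n : ℕ) (x : ℝ) : ℝ :=
  π⁻¹ * ∫ θ in (0 : ℝ)..π, Real.exp (x * Real.cos θ) * Real.cos (n * θ)

/-- `I₀(x) = π⁻¹ ∫₀^π e^{x cos θ} dθ`. [cite: DLMF, 10.32.1] -/
theorem besselI_zero_eq (x : ℝ) :
    besselI 0 x = π⁻¹ * ∫ θ in (0 : ℝ)..π, Real.exp (x * Real.cos θ) := by
  simp [besselI]

/-- `I₀(0) = 1`. [cite: DLMF, 10.30.1] -/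
theorem besselI_zero_apply_zero : besselI 0 0 = 1 := by
  rw [besselI_zero_eq]
  simp [Real.pi_ne_zero]

/-- `I₀(x) > 0` for every real `x` (the integrand `e^{x cos θ}` is positive). [folklore] -/
theorem besselI_zero_pos (x : ℝ) : 0 < besselI 0 x := by
  rw [besselI_zero_eq]
  refine mul_pos (inv_pos.2 Real.pi_pos) ?_
  refine intervalIntegral.intervalIntegral_pos_of_pos_on ?_ (fun θ _ => Real.exp_pos _) Real.pi_pos
  exact (Real.continuous_exp.comp (continuous_const.mul Real.continuous_cos)).intervalIntegrable _ _

/-! ### `K_ν` on the real line -/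

/-- **The real Macdonald function** `K_ν(x) = ∫₀^∞ e^{-x cosh t} cosh(νt) dt` for real order and
real argument (DLMF 10.32.9; absolutely convergent for `x > 0`, junk `0` for `x ≤ 0`, never used):
the real part of the tree's complex `besselK` (`ofReal_besselKReal`). [cite: DLMF, 10.32.9] -/
def besselKReal (ν x : ℝ) : ℝ :=
  ∫ t in Ioi (0 : ℝ), Real.exp (-x * Real.cosh t) * Real.cosh (ν * t)

/-- `besselKReal` is the tree's `besselK` at real data. [cite: DLMF, 10.32.9] -/
theorem ofReal_besselKReal (ν x : ℝ) : (besselKReal ν x : ℂ) = besselK ν x :=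
  (besselK_ofReal ν x).symm

/-- `K₀(x) = ∫₀^∞ e^{-x cosh t} dt`. [cite: DLMF, 10.32.9] -/
theorem besselKReal_zero_eq (x : ℝ) :
    besselKReal 0 x = ∫ t in Ioi (0 : ℝ), Real.exp (-x * Real.cosh t) := by
  simp [besselKReal]

/-- `K_ν(x) > 0` for `x > 0`. [folklore] -/
theorem besselKReal_pos (ν : ℝ) {x : ℝ} (hx : 0 < x) : 0 < besselKReal ν x := by
  have h := besselK_ofReal_re_pos ν hx
  rwa [← ofReal_besselKReal, Complex.ofReal_re] at h

/-! ### Bessel moments -/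

/-- **Bessel moments** `IKM(a,b;n) := ∫₀^∞ [I₀(t)]^a [K₀(t)]^b tⁿ dt` (Zhou's normalisation;
"the non-negative integers `a, b, n` are chosen to ensure convergence" — as a Bochner integral the
value is the junk `0` otherwise; FSY's `IKM_k(i,j) = (-1)^{k-i} 2^{k-j} (πi)^i IKM(i, k-i; j)`).
[cite: Zhou2017, §1 (definition of IKM(a,b;n))] -/
def besselMoment (a b n : ℕ) : ℝ :=
  ∫ t in Ioi (0 : ℝ), besselI 0 t ^ a * besselKReal 0 t ^ b * t ^ n

/-- Zhou's alternating sums `Z_{2n,j} := ∑_{m=0}^{⌊n/2⌋} (-1)^m binom(n,2m)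
∫₀^∞ [π I₀(t)]^{n-2m} [K₀(t)]^{n+2m} t^j dt` (as printed, with `[πI₀]` inside the integral;
Zhou indexes them `Z_{2n,n-2k}`, i.e. `j = n - 2k`). [cite: Zhou2017, (1.1)] -/
def zhouZ (n j : ℕ) : ℝ :=
  ∑ m ∈ Finset.range (n / 2 + 1), (-1 : ℝ) ^ m * (n.choose (2 * m) : ℝ) *
    ∫ t in Ioi (0 : ℝ), (π * besselI 0 t) ^ (n - 2 * m) * besselKReal 0 t ^ (n + 2 * m) * t ^ j

/-! ### The B³G sum rule (named fact) and the `k = 6` rule (proved from it) -/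

/-- **Zhou 2017, Thm. 3.3 (Bailey–Borwein–Broadhurst–Glasser sum rule)** (NAMED FACT, statement
only). "We have `Z_{2n,n-2k} := ∑_{m=0}^{⌊n/2⌋} (-1)^m binom(n,2m) ∫₀^∞ [π I₀(t)]^{n-2m}
[K₀(t)]^{n+2m} t^{n-2k} dt = 0` for all integer pairs `(n, k)` meeting the requirements
`n ≥ 2k ≥ 2`." (Conjecture 1.1 of Bailey–Borwein–Broadhurst–Glasser 2008, proved by Hilbert
transforms; reproved for the corresponding range by Fresán–Sabbah–Yu 2023, Cor. 7 / Rem. 8, from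
the Stokes formula for `Sym^k Kl₂`.) All moments in the sum converge absolutely for `n ≥ 2k ≥ 2`.
[cite: Zhou2017, Thm. 3.3] [cite: FresanSabbahYu2023, Cor. 7 and Rem. 8] -/
def Zhou2017_B3G_sumRule : Prop :=
  ∀ n k : ℕ, 1 ≤ k → 2 * k ≤ n → zhouZ n (n - 2 * k) = 0

/-- Pulling the constant `π^j` out of a moment: `∫ (πI₀)^a K₀^b tⁿ = π^a · IKM(a,b;n)`.
[folklore] -/
theorem integral_pi_mul_besselI_pow (a b n : ℕ) :
    ∫ t in Ioi (0 : ℝ), (π * besselI 0 t) ^ a * besselKReal 0 t ^ b * t ^ n =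
      π ^ a * besselMoment a b n := by
  rw [besselMoment, ← integral_const_mul]
  congr 1
  ext t
  ring

/-- **The `k = 6` sum rule** `π² ∫₀^∞ I₀(t)³K₀(t)³ t dt = 3 ∫₀^∞ I₀(t)K₀(t)⁵ t dt`, i.e.
`π² IKM(3,3;1) = 3 IKM(1,5;1)` — Zhou's `Z_{6,1} = 0` (the case `(n, k) = (3, 1)` of Thm. 3.3:
"`∫₀^∞ [πI₀(t)]³[K₀(t)]³t dt - 3∫₀^∞ πI₀(t)[K₀(t)]⁵t dt = Z_{6,1}`"), equivalently
Fresán–Sabbah–Yu Cor. 7 at `k = 6`, `j = 1` (`3 IKM₆(1,1) + IKM₆(3,1) = 0`, no regularisation).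
PROVED from the named fact. [cite: Zhou2017, Thm. 3.3 ((n,k) = (3,1)) and §3.1 (Z_{6,1} = 0)]
[cite: FresanSabbahYu2023, Cor. 7 (k = 6, j = 1)] -/
theorem Zhou2017_B3G_sumRule.six_one (h : Zhou2017_B3G_sumRule) :
    π ^ 2 * besselMoment 3 3 1 = 3 * besselMoment 1 5 1 := by
  have h0 := h 3 1 le_rfl (by norm_num)
  have hr : 3 / 2 + 1 = 2 := by norm_num
  simp only [zhouZ, hr, Finset.sum_range_succ, Finset.sum_range_zero, zero_add,
    integral_pi_mul_besselI_pow] at h0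
  norm_num [Nat.choose] at h0
  -- h0 : π ^ 3 * besselMoment 3 3 1 - 3 * (π * besselMoment 1 5 1) = 0  (up to normal form)
  have hπ : π ≠ 0 := Real.pi_ne_zero
  have key : π * (π ^ 2 * besselMoment 3 3 1 - 3 * besselMoment 1 5 1) = 0 := by
    linear_combination h0
  rcases mul_eq_zero.1 key with h1 | h1
  · exact (hπ h1).elim
  · linarith

end Literature.Analysis.FunctionSpaces
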